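import Literature.AlgebraicGeometry.CossartJannsenSaito2020.ProjDirProjectiveSpace
import Literature.AlgebraicGeometry.CossartJannsenSaito2020.ProjDirProjectiveLineRegular
import Literature.RingTheory.HilbertSamuel.ProjDirectrixSpace
import Literature.RingTheory.HilbertSamuel.ProjDirectrixSpaceChart
import Literature.RingTheory.KrullDimension.AffineCatenary
import Mathlib.RingTheory.AlgebraicIndependent.TranscendenceBasis
import Mathlib.RingTheory.Localization.FractionRing
import HarnessLib

/-!
# CJS LNM 2270, p. 103 L27–L33 / (6.24): the δ-formula on `C_1 = ℙ(Dir_x(X)) ≅ ℙ^{t−1}_{k(x)}` —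
# `dim 𝒪_{C_1,y} + δ_{y/x} = t − 1` at EVERY point `y ∈ C_1` — PROOF

Source: V. Cossart, U. Jannsen, S. Saito, *Desingularization: Invariants and Strategy*, LNM **2270** (2020)
[`CossartJannsenSaito2020`], held text chunk p0103: L16 «We note `C_1 ≃ ℙ^{t−1}_k`, where `t = e^O_x(X)`», proof of
Lemma 6.33 L27–L29 «`e_{η_1}(X') ≤ e_y(X') − dim(𝒪_{C_1,y}) ≤ e_x(X) − δ_{y/x} − dim(𝒪_{C_1,y}) = e_x(X) − δ_{η_1/x}`»
(i.e. `δ_{y/x} + dim(𝒪_{C_1,y}) = δ_{η_1/x}` for every `y ∈ C_1`, with `δ_{·/x} = tr.deg_{k(x)} k(·)`, (2.x)/Thm. 3.10),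
and (6.24) L33 «`e_{η_1}(X_1) = e_x(X) − dim(C_1) = 1`» (`dim C_1 = t − 1`). This is the dimension theory of
`ℙ^{t−1}_{k(x)}`: for every point `y` of `C_1 ≅ ℙ^{t−1}_{k(x)}`, `dim 𝒪_{C_1,y} + tr.deg_{k(x)} k(y) = t − 1`. It was left as
`-- TODO(general form)` in the statement file `ProjDirProjectiveSpace.lean` (p529373); this file PROVES it
(`projDirectrixFibre_ringKrullDim_add_trdeg`), for the reduced closed subscheme structure on `C_1 = projDirectrixFibre π x`
and the `k(x)`-algebra structure on `k(y)` given by `π^*` (`π.residueFieldMap y`), continuing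
`ProjDirProjectiveSpaceLocal.lean` / `ProjDirProjectiveSpaceResidue.lean`:

* on the chart `g : Spec D → X'` at an adapted generator, `C_1 = V(𝔑)` with `Ξ : k(x)[T_1, …, T_q] ≅ D/𝔑`
  (`ProjDirectrixSpaceChart.lean`), `y = g(w)`, `𝔑 ⊆ 𝔭_w`; `𝒪_{C_1,y} ≅ D_w/𝔑 D_w`, a localisation of `D/𝔑` at
  `w̄ = 𝔭_w/𝔑`, so `dim 𝒪_{C_1,y} = height(w̄)` (Mathlib `IsLocalization.AtPrime.ringKrullDim_eq_height`);
* `k(y) ⊇ R_1 := k(x)[t̄_1, …, t̄_q]` (the values of the chart ratios) and every element of `k(y) = Frac(D/𝔭_w)` is a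
  quotient of two elements of `R_1` (SURJ of the chart ring), so `k(y)` is algebraic over `R_1` and
  `tr.deg_{k(x)} k(y) = tr.deg_{k(x)} R_1` (Mathlib `trdeg_add_eq`, `trdeg_eq_zero`); `R_1 ≅ k(x)[T]/𝔮₀`, `𝔮₀` the kernel of the
  evaluation, and under `D/𝔑 ≅ k(x)[T]` the prime `w̄` corresponds to `𝔮₀` (a chart element `P(t₀)` dies in `k(y)` iff it
  lies in `𝔭_w`), so `height(w̄) = height(𝔮₀)` (Mathlib `RingEquiv.height_comap`);
* `height 𝔮₀ + dim k(x)[T]/𝔮₀ = q` (affine domains are catenary: tree `ringKrullDim_quotient_add_height`) and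
  `dim k(x)[T]/𝔮₀ = tr.deg_{k(x)} (k(x)[T]/𝔮₀)` (tree `exists_ringKrullDim_eq_and_trdeg_eq`).

Boundary-free. NOT a statement of H. Hironaka's manuscript; a PROOF of a consequence of a printed statement of [CJS 2020]
(the identification `C_1 ≅ ℙ^{t−1}_{k(x)}` and the way its dimension theory is used on p. 103) for the L-lane of cell
res-hironaka ([L W4.2] support). AI-written (res-type-031); weaker than expert review.

## References

* V. Cossart, U. Jannsen, S. Saito, LNM 2270 (2020), Def. 6.34 (i), Lemma 6.33 and its proof, (6.24), p. 103.
  [CossartJannsenSaito2020]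
* H. Matsumura, *Commutative Ring Theory*, Thm. 5.6 (dimension of affine domains). [Matsumura1987]
* The Stacks Project, Tag 0804 (charts of a blowing up). [StacksProject]
-/

noncomputable section

open CategoryTheory AlgebraicGeometry TopologicalSpace IsLocalRing
open Literature.AlgebraicGeometry.Resolution Literature.RingTheory.HilbertSamuel Literature.RingTheory.MvPolynomial

namespace Literature.AlgebraicGeometry.CossartJannsenSaito2020

universe u

/-! ## Plumbing (private copies of the chart lemmas of `ProjDirClosed.lean`) -/

/-- The chart `g_j : Spec (R[It])_{(c_j t)} → X'` of a blowing up along `C` over an affine open `U` at a member `c_j` of a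
generating family `c` of `C(U)`: an open immersion over `Spec R → X` through `chartBase c j`, containing every point at
which `c_j` generates the exceptional ideal. [cite: StacksProject, Tag 0804] -/
private theorem exists_chart_of_ideal_eq_span₈ {X' X : Scheme.{u}} {π : X' ⟶ X} {C : X.IdealSheafData}
    (hπ : IsBlowup π C) (U : X.affineOpens) {r : ℕ} (c : Fin r → Γ(X, U))
    (hc : C.ideal U = Ideal.span (Set.range c)) (j : Fin r) :
    ∃ g : Spec (.of (chartRing c j)) ⟶ X', IsOpenImmersion g ∧
      g ≫ π = Spec.map (CommRingCat.ofHom (chartBase c j)) ≫ U.2.fromSpec ∧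
      ∀ (x' : X') (hx : π x' ∈ (U : X.Opens)),
        stalkIdeal (C.comap π) x' =
            Ideal.span {(π.stalkMap x').hom ((X.presheaf.germ U (π x') hx).hom (c j))} →
          x' ∈ Set.range g := by
  have key : ∀ (I : Ideal Γ(X, U)) (_ : C.ideal U = I) (b : Γ(X, U)) (hb : b ∈ I),
      ∃ g : Spec (.of (HomogeneousLocalization.Away (reesGrading I) (reesT b hb))) ⟶ X',
        IsOpenImmersion g ∧
        g ≫ π = Spec.map (CommRingCat.ofHom (reesChartBase b hb)) ≫ U.2.fromSpec ∧
        ∀ (x' : X') (hx : π x' ∈ (U : X.Opens)),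
          stalkIdeal (C.comap π) x' =
              Ideal.span {(π.stalkMap x').hom ((X.presheaf.germ U (π x') hx).hom b)} →
            x' ∈ Set.range g := by
    rintro I rfl b hb
    obtain ⟨g, h1, h2, -⟩ := hπ.exists_charts U
    exact ⟨g b hb, h1 b hb, h2 b hb, fun x' hx hgen =>
      hπ.mem_range_chart_of_stalkIdeal_eq_span U hb (g b hb) (h2 b hb) hx hgen⟩
  exact key _ hc (c j) (Ideal.mem_span_range_self (f := c) (x := j))

/-- On a chart `g : Spec D → X'` with `g ≫ π = Spec f ≫ (Spec Γ(X, U) → X)`: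
`g^♯_w ∘ π^♯_{g w} ∘ germ = (D → 𝒪_{Spec D, w}) ∘ f`. [cite: StacksProject, Tag 0804] -/
private theorem stalkMap_stalkMap_germ_of_chart₈ {X' X : Scheme.{u}} (π : X' ⟶ X) (U : X.affineOpens)
    {D : CommRingCat.{u}} (g : Spec D ⟶ X') (f : Γ(X, U) ⟶ D)
    (hg : g ≫ π = Spec.map f ≫ U.2.fromSpec) (w : Spec D) (hx : π (g w) ∈ (U : X.Opens)) (r : Γ(X, U)) :
    (g.stalkMap w).hom ((π.stalkMap (g w)).hom ((X.presheaf.germ U (π (g w)) hx).hom r)) =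
      ((Spec D).presheaf.germ ⊤ w trivial).hom ((Scheme.ΓSpecIso D).inv.hom (f.hom r)) := by
  have e := top_le_preimage_of_chart U g f hg
  have h1 : ((Spec D).presheaf.germ ⊤ w trivial).hom ((g ≫ π).appLE U ⊤ e r) =
      ((g ≫ π).stalkMap w).hom ((X.presheaf.germ U ((g ≫ π) w) (e trivial)).hom r) := by
    change ((g ≫ π).appLE U ⊤ e ≫ (Spec D).presheaf.germ ⊤ w trivial).hom r =
      (X.presheaf.germ U ((g ≫ π) w) (e trivial) ≫ (g ≫ π).stalkMap w).hom r
    rw [Scheme.Hom.germ_stalkMap, Scheme.Hom.appLE, Category.assoc, (Spec D).presheaf.germ_res]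
  rw [appLE_chart_eq U g f hg e, Scheme.Hom.stalkMap_comp] at h1
  exact h1.symm

/-- **In a local ring, if `(u_1, …, u_r) = (t)` with `t` a nonzerodivisor, then `(u_j) = (t)` for some `j`.** [folklore] -/
private theorem exists_span_singleton_eq_of_span_range_eq₈ {B : Type u} [CommRing B] [IsLocalRing B] {r : ℕ}
    (u : Fin r → B) {t : B} (ht : t ∈ nonZeroDivisors B) (h : Ideal.span (Set.range u) = Ideal.span {t}) :
    ∃ j, Ideal.span {u j} = Ideal.span {t} := by
  classical
  have hb : ∀ l, ∃ b : B, b * t = u l := fun l =>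
    Ideal.mem_span_singleton'.mp (h ▸ Ideal.subset_span ⟨l, rfl⟩)
  choose b hb using hb
  obtain ⟨a, ha⟩ : ∃ a : Fin r → B, ∑ l, a l * u l = t :=
    Ideal.mem_span_range_iff_exists_fun.mp (h.symm ▸ Ideal.mem_span_singleton_self t)
  have hsum : ∑ l, a l * b l = 1 := by
    have h1 : (∑ l, a l * b l - 1) * t = 0 := by
      rw [sub_mul, one_mul, Finset.sum_mul, sub_eq_zero]
      conv_rhs => rw [← ha]
      exact Finset.sum_congr rfl fun l _ => by rw [mul_assoc, hb l]
    exact sub_eq_zero.mp ((mem_nonZeroDivisors_iff_right.mp ht) _ h1)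
  have hex : ∃ j, IsUnit (a j * b j) := by
    by_contra hall
    simp only [not_exists] at hall
    have hmem : ∑ l, a l * b l ∈ maximalIdeal B :=
      Ideal.sum_mem _ fun l _ => (mem_maximalIdeal _).mpr (mem_nonunits_iff.mpr (hall l))
    rw [hsum] at hmem
    exact (mem_maximalIdeal _).mp hmem isUnit_one
  obtain ⟨j, hj⟩ := hex
  refine ⟨j, ?_⟩
  have hbj : IsUnit (b j) := isUnit_of_mul_isUnit_right hj
  rw [← hb j, Ideal.span_singleton_mul_left_unit hbj]

/-- An ideal with quotient `≅ k[T_1, …, T_q]` (`k` a field) is prime. [folklore] -/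
private theorem isPrime_of_ringEquiv_mvPolynomial₈ {D : Type u} [CommRing D] {k : Type u} [Field k] {q : ℕ}
    (N : Ideal D) (Ξ : MvPolynomial (Fin q) k ≃+* D ⧸ N) : N.IsPrime := by
  haveI : IsDomain (D ⧸ N) := MulEquiv.isDomain (MvPolynomial (Fin q) k) Ξ.symm.toMulEquiv
  exact (Ideal.Quotient.isDomain_iff_prime N).mp inferInstance


/-! ## One chart: dimension and residual transcendence degree at a chart point `g(w)`, `𝔑 ⊆ 𝔭_w` -/

section ChartDimension

variable {X' X : Scheme.{u}} (π : X' ⟶ X) (U : X.affineOpens)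
  {D : CommRingCat.{u}} (ψ : Γ(X, U) ⟶ D) (g : Spec D ⟶ X') [IsOpenImmersion g]
  (hgπ : g ≫ π = Spec.map ψ ≫ U.2.fromSpec) (w : Spec D) (hwU : π (g w) ∈ (U : X.Opens))
  (𝔭 : Ideal Γ(X, U)) [h𝔭max : 𝔭.IsMaximal] (h𝔭 : 𝔭 = (U.2.primeIdealOf ⟨π (g w), hwU⟩).asIdeal) {q : ℕ}
  (t₀ : Fin q → D) (N : Ideal D) (hN : N.IsPrime) (hNw : N ≤ w.asIdeal)
  (Ξ : MvPolynomial (Fin q) (Γ(X, U) ⧸ 𝔭) ≃+* D ⧸ N)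
  (hΞC : ∀ ρ : Γ(X, U), Ξ (MvPolynomial.C (Ideal.Quotient.mk 𝔭 ρ)) = Ideal.Quotient.mk N (ψ.hom ρ))
  (hΞX : ∀ m : Fin q, Ξ (MvPolynomial.X m) = Ideal.Quotient.mk N (t₀ m))
  (hsurj : ∀ d : D, ∃ P : MvPolynomial (Fin q) Γ(X, U), d - MvPolynomial.eval₂ ψ.hom t₀ P ∈ N)
  (S : Set X') (hC : IsClosed S) (hGP : IsGenericPoint (g ⟨N, hN⟩) S)

include hgπ h𝔭max h𝔭 hNw hΞC hΞX hsurj hGP in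
/-- **On a chart `g : Spec D → X'` whose point `N` (prime, `Ξ : k[T_1, …, T_q] ≅ D/N`, `k = Γ(X, U)/𝔭_x`, `T_m ↦ t₀_m`) is
generic in the closed set `S`: at every point `y = g(w)` with `N ⊆ 𝔭_w` (i.e. `y ∈ S`),
`dim (𝒪_{X',y}/𝓘_{S,y}) + tr.deg_{k(π y)} k(y) = q`.** `𝒪_{X',y}/𝓘_{S,y} ≅ D_w/N D_w` is the localisation of
`D/N ≅ k[T]` at `w̄`, of dimension `height w̄`; `k(y) = Frac(D/𝔭_w)` is algebraic over the image `R_1 ≅ k[T]/𝔮₀` of the chart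
evaluation (every element is a quotient of two values), `w̄ ↦ 𝔮₀` under `D/N ≅ k(π y)[T]`, and
`height 𝔮₀ + tr.deg (k[T]/𝔮₀) = q` (affine domains). [cite: CossartJannsenSaito2020, Lemma 6.33 (proof), (6.24), p. 103] -/
theorem ringKrullDim_quotient_stalkIdeal_add_trdeg_of_chart :
    letI : Algebra (X.residueField (π.base (g w))) (X'.residueField (g w)) := (π.residueFieldMap (g w)).hom.toAlgebra
    ∃ d e : ℕ,
      ringKrullDim (X'.presheaf.stalk (g w) ⧸ stalkIdeal (Scheme.IdealSheafData.vanishingIdeal ⟨S, hC⟩) (g w)) = d ∧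
        Algebra.trdeg (X.residueField (π.base (g w))) (X'.residueField (g w)) = e ∧ d + e = q := by
  classical
  letI algK : Algebra (X.residueField (π.base (g w))) (X'.residueField (g w)) :=
    (π.residueFieldMap (g w)).hom.toAlgebra
  -- the local dictionary at `w`
  let φ' : Γ(X, U) →+* X'.presheaf.stalk (g w) :=
    (π.stalkMap (g w)).hom.comp (X.presheaf.germ U (π.base (g w)) hwU).hom
  let σ : ↑(X'.presheaf.stalk (g w)) ≃+* ↑((Spec D).presheaf.stalk w) := (asIso (g.stalkMap w)).commRingCatIsoToRingEquiv
  have hσ : ∀ b, σ b = (g.stalkMap w).hom b := fun _ => rfl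
  let τ : D ⟶ (Spec D).presheaf.stalk w := (Scheme.ΓSpecIso D).inv ≫ (Spec D).presheaf.germ ⊤ w trivial
  letI : Algebra D ((Spec D).presheaf.stalk w) := τ.hom.toAlgebra
  haveI hlocL : IsLocalization.AtPrime ((Spec D).presheaf.stalk w) w.asIdeal :=
    StructureSheaf.IsLocalization.to_stalk (R := D) w
  have hστ : ∀ s : Γ(X, U), σ (φ' s) = τ.hom (ψ.hom s) := fun s =>
    stalkMap_stalkMap_germ_of_chart₈ π U g ψ hgπ w hwU s
  have hσm : ∀ b, b ∈ maximalIdeal (X'.presheaf.stalk (g w)) ↔ σ b ∈ maximalIdeal ((Spec D).presheaf.stalk w) := by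
    intro b
    rw [mem_maximalIdeal, mem_maximalIdeal, mem_nonunits_iff, mem_nonunits_iff, MulEquiv.isUnit_map σ]
  have hτw : ∀ d : D, d ∈ w.asIdeal ↔ τ.hom d ∈ maximalIdeal ((Spec D).presheaf.stalk w) :=
    fun d => (IsLocalization.AtPrime.to_map_mem_maximal_iff ((Spec D).presheaf.stalk w) w.asIdeal d).symm
  -- residue fields: `K₀ = k(π g w)`, `K₁ = k(g w)`, `ρ₀ : K₀ → K₁`
  set K₀ := X.residueField (π.base (g w)) with hK₀
  set K₁ := X'.residueField (g w) with hK₁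
  let ρ₀ : K₀ →+* K₁ := (π.residueFieldMap (g w)).hom
  have hρ₀ : algebraMap K₀ K₁ = ρ₀ := rfl
  let res₁ : X'.presheaf.stalk (g w) →+* K₁ := (X'.residue (g w)).hom
  let res₀ : X.presheaf.stalk (π.base (g w)) →+* K₀ := (X.residue (π.base (g w))).hom
  have hres : ∀ a', ρ₀ (res₀ a') = res₁ ((π.stalkMap (g w)).hom a') := by
    intro a'
    change (X.residue _ ≫ π.residueFieldMap (g w)).hom a' = (π.stalkMap (g w) ≫ X'.residue _).hom a'
    rw [Scheme.residue_residueFieldMap]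
  have hres₁_zero : ∀ b, res₁ b = 0 ↔ b ∈ maximalIdeal (X'.presheaf.stalk (g w)) :=
    fun b => IsLocalRing.residue_eq_zero_iff b
  -- the coefficient map `χ : Γ(X, U) → K₀` is onto with kernel `𝔭`
  let χ : Γ(X, U) →+* K₀ := res₀.comp (X.presheaf.germ U (π.base (g w)) hwU).hom
  letI : Algebra Γ(X, U) (X.presheaf.stalk (π.base (g w))) :=
    TopCat.Presheaf.algebra_section_stalk X.presheaf (⟨π.base (g w), hwU⟩ : (U : X.Opens))
  haveI hlocη : IsLocalization.AtPrime (X.presheaf.stalk (π.base (g w))) 𝔭 :=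
    h𝔭 ▸ U.2.isLocalization_stalk ⟨π.base (g w), hwU⟩
  have hχsurj : Function.Surjective χ := by
    intro q'
    obtain ⟨a₀, rfl⟩ := Ideal.Quotient.mk_surjective q'
    obtain ⟨⟨ρ, s⟩, hρs⟩ := IsLocalization.surj 𝔭.primeCompl a₀
    obtain ⟨y, i, hi, hyi⟩ := h𝔭max.exists_inv s.2
    refine ⟨y * ρ, ?_⟩
    change res₀ (algebraMap Γ(X, U) _ (y * ρ)) = res₀ a₀
    rw [← sub_eq_zero, ← map_sub]
    change IsLocalRing.residue _ _ = 0
    rw [IsLocalRing.residue_eq_zero_iff]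
    have hs : a₀ * algebraMap Γ(X, U) _ s = algebraMap Γ(X, U) _ ρ := hρs
    have h1 : algebraMap Γ(X, U) (X.presheaf.stalk (π.base (g w))) (y * ρ) - a₀ =
        -(algebraMap Γ(X, U) _ i * a₀) +
          (algebraMap Γ(X, U) _ y * algebraMap Γ(X, U) _ s + algebraMap Γ(X, U) _ i - 1) * a₀ := by
      rw [map_mul]
      linear_combination (-(algebraMap Γ(X, U) (X.presheaf.stalk (π.base (g w))) y)) * hs
    have h2 : algebraMap Γ(X, U) (X.presheaf.stalk (π.base (g w))) y * algebraMap Γ(X, U) _ s +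
        algebraMap Γ(X, U) _ i - 1 = 0 := by
      rw [← map_mul, ← map_add, hyi, map_one, sub_self]
    rw [h1, h2, zero_mul, add_zero]
    exact Submodule.neg_mem _ (Ideal.mul_mem_right _ _
      ((IsLocalization.AtPrime.to_map_mem_maximal_iff _ 𝔭 i).mpr hi))
  have hχker : ∀ ρ ∈ 𝔭, χ ρ = 0 := by
    intro ρ hρ
    change IsLocalRing.residue _ (algebraMap Γ(X, U) (X.presheaf.stalk (π.base (g w))) ρ) = 0
    rw [IsLocalRing.residue_eq_zero_iff]
    exact (IsLocalization.AtPrime.to_map_mem_maximal_iff _ 𝔭 ρ).mpr hρ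
  have hkerχ : RingHom.ker χ = 𝔭 := by
    refine (h𝔭max.eq_of_le (RingHom.ker_ne_top χ) fun ρ hρ => ?_).symm
    exact (RingHom.mem_ker).mpr (hχker ρ hρ)
  -- `χ̄ : Γ(X, U)/𝔭 ≅ K₀` and `θ : (Γ/𝔭)[T] ≅ K₀[T]`
  let χb : (Γ(X, U) ⧸ 𝔭) ≃+* K₀ :=
    (Ideal.quotEquivOfEq hkerχ.symm).trans (RingHom.quotientKerEquivOfSurjective hχsurj)
  have hχb : ∀ ρ, χb (Ideal.Quotient.mk 𝔭 ρ) = χ ρ := by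
    intro ρ
    change RingHom.quotientKerEquivOfSurjective hχsurj (Ideal.quotEquivOfEq hkerχ.symm (Ideal.Quotient.mk 𝔭 ρ)) = χ ρ
    rw [Ideal.quotEquivOfEq_mk, RingHom.quotientKerEquivOfSurjective_apply_mk]
  let θ : MvPolynomial (Fin q) (Γ(X, U) ⧸ 𝔭) ≃+* MvPolynomial (Fin q) K₀ := MvPolynomial.mapEquiv (Fin q) χb
  have hθ : ∀ P : MvPolynomial (Fin q) Γ(X, U),
      θ (MvPolynomial.map (Ideal.Quotient.mk 𝔭) P) = MvPolynomial.map χ P := by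
    intro P
    change MvPolynomial.map (χb : (Γ(X, U) ⧸ 𝔭) →+* K₀) (MvPolynomial.map (Ideal.Quotient.mk 𝔭) P) = _
    rw [MvPolynomial.map_map]
    have hcomp : (χb : (Γ(X, U) ⧸ 𝔭) →+* K₀).comp (Ideal.Quotient.mk 𝔭) = χ := RingHom.ext fun ρ => hχb ρ
    rw [hcomp]
  -- `Ξ` on reductions of polynomials over `Γ(X, U)`
  have hΞ : ∀ P : MvPolynomial (Fin q) Γ(X, U),
      Ξ (MvPolynomial.map (Ideal.Quotient.mk 𝔭) P) = Ideal.Quotient.mk N (MvPolynomial.eval₂ ψ.hom t₀ P) := by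
    intro P
    have hhom : (Ξ : MvPolynomial (Fin q) (Γ(X, U) ⧸ 𝔭) →+* D ⧸ N).comp (MvPolynomial.map (Ideal.Quotient.mk 𝔭)) =
        (Ideal.Quotient.mk N).comp (MvPolynomial.eval₂Hom ψ.hom t₀) := by
      refine MvPolynomial.ringHom_ext (fun ρ => ?_) (fun m => ?_)
      · change Ξ (MvPolynomial.map _ (MvPolynomial.C ρ)) = Ideal.Quotient.mk N (MvPolynomial.eval₂Hom ψ.hom t₀ (MvPolynomial.C ρ))
        rw [MvPolynomial.map_C, MvPolynomial.eval₂Hom_C]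
        exact hΞC ρ
      · change Ξ (MvPolynomial.map _ (MvPolynomial.X m)) = Ideal.Quotient.mk N (MvPolynomial.eval₂Hom ψ.hom t₀ (MvPolynomial.X m))
        rw [MvPolynomial.map_X, MvPolynomial.eval₂Hom_X']
        exact hΞX m
    exact RingHom.congr_fun hhom P
  -- the evaluation `ev : K₀[T] → K₁`, `T_m ↦ t̄_m`, as a `K₀`-algebra map
  set t : Fin q → K₁ := fun m => res₁ (σ.symm (τ.hom (t₀ m))) with ht
  let ev : MvPolynomial (Fin q) K₀ →ₐ[K₀] K₁ := MvPolynomial.aeval t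
  have hev : ∀ P : MvPolynomial (Fin q) Γ(X, U),
      ev (MvPolynomial.map χ P) = res₁ (σ.symm (τ.hom (MvPolynomial.eval₂ ψ.hom t₀ P))) := by
    intro P
    have hhom : (ev : MvPolynomial (Fin q) K₀ →+* K₁).comp (MvPolynomial.map χ) =
        (res₁.comp ((σ.symm : _ →+* _).comp τ.hom)).comp (MvPolynomial.eval₂Hom ψ.hom t₀) := by
      refine MvPolynomial.ringHom_ext (fun r => ?_) (fun m => ?_)
      · change ev (MvPolynomial.map χ (MvPolynomial.C r)) =
          res₁ (σ.symm (τ.hom (MvPolynomial.eval₂Hom ψ.hom t₀ (MvPolynomial.C r))))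
        rw [MvPolynomial.map_C, MvPolynomial.eval₂Hom_C, MvPolynomial.algHom_C, hρ₀]
        change ρ₀ (res₀ _) = _
        rw [hres, ← hστ r, σ.symm_apply_apply]
        rfl
      · change ev (MvPolynomial.map χ (MvPolynomial.X m)) =
          res₁ (σ.symm (τ.hom (MvPolynomial.eval₂Hom ψ.hom t₀ (MvPolynomial.X m))))
        rw [MvPolynomial.map_X, MvPolynomial.aeval_X, MvPolynomial.eval₂Hom_X']
    exact RingHom.congr_fun hhom P
  have hev0 : ∀ P : MvPolynomial (Fin q) Γ(X, U),
      ev (MvPolynomial.map χ P) = 0 ↔ MvPolynomial.eval₂ ψ.hom t₀ P ∈ w.asIdeal := by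
    intro P
    rw [hev, hres₁_zero, hσm, σ.apply_symm_apply, ← hτw]
  -- the kernel `𝔮₀` of `ev`, the image `R₁` of `ev`, and `Θ : D/N ≅ K₀[T]` carrying `w̄` to `𝔮₀`
  set 𝔮₀ : Ideal (MvPolynomial (Fin q) K₀) := RingHom.ker (ev : MvPolynomial (Fin q) K₀ →+* K₁) with h𝔮₀
  haveI h𝔮₀p : 𝔮₀.IsPrime := RingHom.ker_isPrime _
  let Θ : (D ⧸ N) ≃+* MvPolynomial (Fin q) K₀ := Ξ.symm.trans θ
  set wb : Ideal (D ⧸ N) := w.asIdeal.map (Ideal.Quotient.mk N) with hwb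
  have hmkw : ∀ d : D, Ideal.Quotient.mk N d ∈ wb ↔ d ∈ w.asIdeal := by
    intro d
    constructor
    · intro hd
      have h1 : d ∈ (w.asIdeal.map (Ideal.Quotient.mk N)).comap (Ideal.Quotient.mk N) := hd
      rw [Ideal.comap_map_of_surjective _ Ideal.Quotient.mk_surjective] at h1
      obtain ⟨a, ha, b, hb, hab⟩ := Submodule.mem_sup.mp h1
      have hb' : b ∈ N := by
        rw [Ideal.mem_comap, Ideal.mem_bot, Ideal.Quotient.eq_zero_iff_mem] at hb
        exact hb
      rw [← hab]
      exact w.asIdeal.add_mem ha (hNw hb')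
    · exact fun hd => Ideal.mem_map_of_mem _ hd
  have hcomapΘ : 𝔮₀.comap (Θ : (D ⧸ N) →+* MvPolynomial (Fin q) K₀) = wb := by
    ext db
    obtain ⟨d, rfl⟩ := Ideal.Quotient.mk_surjective db
    obtain ⟨P, hP⟩ := hsurj d
    have hdP : Ideal.Quotient.mk N d = Ideal.Quotient.mk N (MvPolynomial.eval₂ ψ.hom t₀ P) := by
      rw [Ideal.Quotient.eq]
      exact hP
    have hΘd : Θ (Ideal.Quotient.mk N d) = MvPolynomial.map χ P := by
      rw [hdP, ← hΞ P]
      change θ (Ξ.symm (Ξ _)) = _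
      rw [Ξ.symm_apply_apply, hθ]
    rw [Ideal.mem_comap, hmkw]
    change Θ (Ideal.Quotient.mk N d) ∈ 𝔮₀ ↔ _
    rw [hΘd, h𝔮₀, RingHom.mem_ker]
    change ev (MvPolynomial.map χ P) = 0 ↔ _
    rw [hev0]
    constructor
    · intro h
      have : d = (d - MvPolynomial.eval₂ ψ.hom t₀ P) + MvPolynomial.eval₂ ψ.hom t₀ P := by ring
      rw [this]
      exact w.asIdeal.add_mem (hNw hP) h
    · intro h
      have : MvPolynomial.eval₂ ψ.hom t₀ P = d - (d - MvPolynomial.eval₂ ψ.hom t₀ P) := by ring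
      rw [this]
      exact w.asIdeal.sub_mem h (hNw hP)
  have hheight : wb.height = 𝔮₀.height := by
    rw [← hcomapΘ]
    exact RingEquiv.height_comap Θ 𝔮₀
  -- (1) `dim (𝒪_{X',gw}/𝓘_{S,gw}) = height w̄`
  set ηpt : Spec D := ⟨N, hN⟩ with hηpt
  have h' : ηpt ⤳ w :=
    (PrimeSpectrum.le_iff_specializes ηpt w).mp ((PrimeSpectrum.asIdeal_le_asIdeal ηpt w).mp hNw)
  have h : g ηpt ⤳ g w := h'.map g.continuous
  have hCl : (⟨S, hC⟩ : Closeds X') = ⟨closure {g ηpt}, isClosed_closure⟩ := Closeds.ext hGP.symm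
  have hstalk : stalkIdeal (Scheme.IdealSheafData.vanishingIdeal ⟨S, hC⟩) (g w) = primeOfSpecializes h := by
    rw [hCl]
    exact stalkIdeal_vanishingIdeal_closure h
  obtain ⟨e⟩ := nonempty_quotient_primeOfSpecializes_ringEquiv g ηpt w h' h
  set Q := ((Spec D).presheaf.stalk w) ⧸ N.map (algebraMap D ((Spec D).presheaf.stalk w)) with hQ
  have hker : RingHom.ker (Ideal.Quotient.mk N) ≤ w.asIdeal := by rw [Ideal.mk_ker]; exact hNw
  haveI hwbp : wb.IsPrime := Ideal.map_isPrime_of_surjective Ideal.Quotient.mk_surjective hker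
  have hsub : Algebra.algebraMapSubmonoid (D ⧸ N) w.asIdeal.primeCompl = wb.primeCompl := by
    ext q'
    constructor
    · rintro ⟨s, hs, rfl⟩
      exact fun hq => hs ((hmkw s).mp hq)
    · intro hq
      obtain ⟨s, rfl⟩ := Ideal.Quotient.mk_surjective q'
      exact ⟨s, fun hs => hq ((hmkw s).mpr hs), rfl⟩
  haveI hQloc : IsLocalization.AtPrime Q wb := by
    have hl : IsLocalization (Algebra.algebraMapSubmonoid (D ⧸ N) w.asIdeal.primeCompl) Q := inferInstance
    rwa [hsub] at hl
  have hdimQ : ringKrullDim Q = wb.height := IsLocalization.AtPrime.ringKrullDim_eq_height wb Q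
  have hdim : ringKrullDim (X'.presheaf.stalk (g w) ⧸
      stalkIdeal (Scheme.IdealSheafData.vanishingIdeal ⟨S, hC⟩) (g w)) = 𝔮₀.height := by
    rw [hstalk, ringKrullDim_eq_of_ringEquiv e, hdimQ, hheight]
  -- (2) `height 𝔮₀ + dim K₀[T]/𝔮₀ = q` and `dim K₀[T]/𝔮₀ = trdeg_{K₀} K₀[T]/𝔮₀ = n`
  haveI : IsDomain (MvPolynomial (Fin q) K₀ ⧸ 𝔮₀) := (Ideal.Quotient.isDomain_iff_prime 𝔮₀).mpr h𝔮₀p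
  haveI : Algebra.FiniteType K₀ (MvPolynomial (Fin q) K₀ ⧸ 𝔮₀) :=
    Algebra.FiniteType.of_surjective (Ideal.Quotient.mkₐ K₀ 𝔮₀) (Ideal.Quotient.mkₐ_surjective K₀ 𝔮₀)
  obtain ⟨n, hn, htr⟩ :=
    exists_ringKrullDim_eq_and_trdeg_eq K₀ (MvPolynomial (Fin q) K₀ ⧸ 𝔮₀)
  have hcat := Literature.RingTheory.KrullDimension.ringKrullDim_quotient_add_height (F := K₀) 𝔮₀
  rw [hn, MvPolynomial.ringKrullDim_of_isNoetherianRing, ringKrullDim_eq_zero_of_field, Nat.card_eq_fintype_card,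
    Fintype.card_fin, zero_add] at hcat
  -- so `height 𝔮₀ = d` with `n + d = q`
  obtain ⟨d, hd, hnd⟩ : ∃ d : ℕ, 𝔮₀.height = d ∧ n + d = q := by
    by_cases htop : 𝔮₀.height = ⊤
    · -- infinite height contradicts `n + height = q`
      exfalso
      have h1 : ((n : WithBot ℕ∞)) + ((𝔮₀.height : ℕ∞) : WithBot ℕ∞) = ⊤ := by
        rw [htop]; rfl
      rw [h1] at hcat
      have h3 : ((⊤ : ℕ∞) : WithBot ℕ∞) = ((q : ℕ∞) : WithBot ℕ∞) := by
        rw [WithBot.coe_natCast]; exact hcat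
      exact ENat.coe_ne_top q (WithBot.coe_injective h3).symm
    · obtain ⟨d, hd⟩ := ENat.ne_top_iff_exists.mp htop
      refine ⟨d, hd.symm, ?_⟩
      rw [← hd] at hcat
      have h2 : ((n : WithBot ℕ∞)) + ((d : ℕ∞) : WithBot ℕ∞) = ((n + d : ℕ) : WithBot ℕ∞) := by
        push_cast; rfl
      rw [h2] at hcat
      exact_mod_cast hcat
  -- (3) `trdeg_{K₀} K₁ = n`: `K₁` is algebraic over the image `R₁ ≅ K₀[T]/𝔮₀` of `ev`
  let R₁ : Subalgebra K₀ K₁ := ev.range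
  have hR₁ : Algebra.trdeg K₀ R₁ = n := by
    rw [← htr]
    exact (AlgEquiv.trdeg_eq (Ideal.quotientKerEquivRange ev)).symm
  haveI : Algebra.IsAlgebraic R₁ K₁ := by
    refine ⟨fun z => ?_⟩
    obtain ⟨b, rfl⟩ := IsLocalRing.residue_surjective z
    obtain ⟨⟨dd, s⟩, hds⟩ := IsLocalization.surj w.asIdeal.primeCompl (σ b)
    obtain ⟨Pd, hPd⟩ := hsurj dd
    obtain ⟨Ps, hPs⟩ := hsurj (s : D)
    have hvd : res₁ (σ.symm (τ.hom dd)) = ev (MvPolynomial.map χ Pd) := by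
      rw [hev, ← sub_eq_zero, ← map_sub, ← map_sub, ← map_sub, hres₁_zero, hσm, σ.apply_symm_apply, ← hτw]
      exact hNw hPd
    have hvs : res₁ (σ.symm (τ.hom (s : D))) = ev (MvPolynomial.map χ Ps) := by
      rw [hev, ← sub_eq_zero, ← map_sub, ← map_sub, ← map_sub, hres₁_zero, hσm, σ.apply_symm_apply, ← hτw]
      exact hNw hPs
    have hvs0 : res₁ (σ.symm (τ.hom (s : D))) ≠ 0 := by
      rw [Ne, hres₁_zero, hσm, σ.apply_symm_apply, ← hτw]
      exact s.2
    have hbds : (res₁ b) * res₁ (σ.symm (τ.hom (s : D))) = res₁ (σ.symm (τ.hom dd)) := by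
      rw [← map_mul]
      congr 1
      apply σ.injective
      rw [map_mul, σ.apply_symm_apply, σ.apply_symm_apply]
      exact hds
    -- `z` is a root of `b' Z − a` with `a, b' ∈ R₁`, `b' ≠ 0`
    let a : R₁ := ⟨ev (MvPolynomial.map χ Pd), ⟨_, rfl⟩⟩
    let b' : R₁ := ⟨ev (MvPolynomial.map χ Ps), ⟨_, rfl⟩⟩
    have hb'0 : b' ≠ 0 := by
      intro h0
      apply hvs0
      rw [hvs]
      exact congrArg Subtype.val h0
    refine ⟨Polynomial.C b' * Polynomial.X - Polynomial.C a, ?_, ?_⟩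
    · intro h0
      have h1 := congrArg (fun p => Polynomial.coeff p 1) h0
      simp only [Polynomial.coeff_sub, Polynomial.coeff_C_mul, Polynomial.coeff_X_one, mul_one, Polynomial.coeff_C,
        one_ne_zero, if_false, sub_zero, Polynomial.coeff_zero] at h1
      exact hb'0 h1
    · rw [map_sub, map_mul, Polynomial.aeval_C, Polynomial.aeval_C, Polynomial.aeval_X]
      change (ev (MvPolynomial.map χ Ps)) * res₁ b - ev (MvPolynomial.map χ Pd) = 0
      rw [← hvs, ← hvd, mul_comm, hbds, sub_self]
  haveI : FaithfulSMul K₀ R₁ := (faithfulSMul_iff_algebraMap_injective K₀ R₁).mpr (algebraMap K₀ R₁).injective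
  have htrK : Algebra.trdeg K₀ K₁ = n := by
    have h1 := trdeg_add_eq K₀ R₁ (A := K₁)
    rw [trdeg_eq_zero (R := R₁) (A := K₁), add_zero, hR₁] at h1
    exact h1.symm
  refine ⟨d, n, ?_, htrK, by omega⟩
  rw [hdim, hd]
  rfl

end ChartDimension

/-! ## The theorem -/

set_option maxHeartbeats 1600000 in
-- one long proof over large chart types (`q + 1` Rees charts `chartRing c j` over `Γ(X, U)`), as in `ProjDirLine.lean`
/-- **CJS 2020, p. 103: the δ-formula on `C_1 = ℙ(Dir_x(X)) ≅ ℙ^{t−1}_{k(x)}`, PROVED** — for a blow-up `π : X' ⟶ X` of a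
locally noetherian `X` in a closed point `x` with `e_x(X) = q + 1` and every point `y` of `C_1 = projDirectrixFibre π x`
(reduced closed subscheme structure, `k(y)` a `k(π y) = k(x)`-algebra through `π^*`):
`dim 𝒪_{C_1,y} + tr.deg_{k(x)} k(y) = q = t − 1` («`δ_{y/x} + dim(𝒪_{C_1,y}) = δ_{η_1/x}`», proof of Lemma 6.33;
`dim C_1 = t − 1`, (6.24)). At a generic point this is `δ_{η_1/x} = t − 1` (cf. `ProjDir_projSpace_genericResidueField_holds`), at
a closed point of `X'` it is `dim 𝒪_{C_1,y} = t − 1` (cf. `ProjDir_projSpace_holds`).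
[cite: CossartJannsenSaito2020, Lemma 6.33 (proof), (6.24), Def. 6.34 (i), p. 103] -/
theorem projDirectrixFibre_ringKrullDim_add_trdeg {X X' : Scheme.{u}} [IsLocallyNoetherian X]
    (π : X' ⟶ X) (x : X) (hx : IsClosed ({x} : Set X))
    (hπ : IsBlowup π (Scheme.IdealSheafData.vanishingIdeal ⟨{x}, hx⟩)) {q : ℕ}
    (hdir : Scheme.dirDim X x = q + 1) (hC : IsClosed (projDirectrixFibre π x)) (y : X')
    (hy : y ∈ projDirectrixFibre π x) :
    letI : Algebra (X.residueField (π.base y)) (X'.residueField y) := (π.residueFieldMap y).hom.toAlgebra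
    ∃ d e : ℕ,
      ringKrullDim (X'.presheaf.stalk y ⧸
        stalkIdeal (Scheme.IdealSheafData.vanishingIdeal ⟨projDirectrixFibre π x, hC⟩) y) = d ∧
      Algebra.trdeg (X.residueField (π.base y)) (X'.residueField y) = e ∧ d + e = q := by
  classical
  set S := projDirectrixFibre π x with hS
  -- (0) the centre, an affine open `U ∋ x`, `𝔭 = 𝔭_x ⊆ R = Γ(X, U)`, `𝒪_{X,x} = R_𝔭`
  obtain ⟨U, hxU⟩ : ∃ U : X.affineOpens, x ∈ (U : X.Opens) := by
    obtain ⟨U₀, hU, hxU, -⟩ :=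
      exists_isAffineOpen_mem_and_subset (X := X) (x := x) (U := ⊤) (Opens.mem_top x)
    exact ⟨⟨U₀, hU⟩, hxU⟩
  set A := X.presheaf.stalk x with hA
  obtain ⟨𝔭, h𝔭⟩ : ∃ 𝔭 : PrimeSpectrum Γ(X, U), 𝔭 = U.2.primeIdealOf ⟨x, hxU⟩ := ⟨_, rfl⟩
  haveI h𝔭max : 𝔭.asIdeal.IsMaximal := h𝔭 ▸ U.2.primeIdealOf_isMaximal_of_isClosed ⟨x, hxU⟩ hx
  haveI : IsNoetherianRing Γ(X, U) := IsLocallyNoetherian.component_noetherian U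
  letI : Algebra Γ(X, U) A := TopCat.Presheaf.algebra_section_stalk X.presheaf (⟨x, hxU⟩ : (U : X.Opens))
  haveI hloc : IsLocalization.AtPrime A 𝔭.asIdeal := h𝔭 ▸ U.2.isLocalization_stalk ⟨x, hxU⟩
  have halg : ∀ s : Γ(X, U), algebraMap Γ(X, U) A s = (X.presheaf.germ U x hxU).hom s := fun _ => rfl
  have hI : (Scheme.IdealSheafData.vanishingIdeal (⟨{x}, hx⟩ : Closeds X)).ideal U = 𝔭.asIdeal := by
    rw [h𝔭]
    exact vanishingIdeal_singleton_ideal U.2 hx hxU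
  obtain ⟨r, c, hc⟩ : ∃ (r : ℕ) (c : Fin r → Γ(X, U)), Ideal.span (Set.range c) = 𝔭.asIdeal :=
    Submodule.fg_iff_exists_fin_generating_family.mp (IsNoetherian.noetherian 𝔭.asIdeal)
  have hIc : (Scheme.IdealSheafData.vanishingIdeal (⟨{x}, hx⟩ : Closeds X)).ideal U = Ideal.span (Set.range c) :=
    hI.trans hc.symm
  have hcm : ∀ l, algebraMap Γ(X, U) A (c l) ∈ maximalIdeal A :=
    fun l => (IsLocalization.AtPrime.to_map_mem_maximal_iff A 𝔭.asIdeal (c l)).mpr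
      (hc ▸ Ideal.subset_span ⟨l, rfl⟩)
  have hspanA : Ideal.span (Set.range fun l => algebraMap Γ(X, U) A (c l)) = maximalIdeal A := by
    have h := IsLocalization.AtPrime.map_eq_maximalIdeal 𝔭.asIdeal A
    rwa [← hc, Ideal.map_span, ← Set.range_comp] at h
  have hexp : ∀ l, ∃ a : Fin (maximalIdeal A).spanFinrank → A,
      ∑ i, a i * minGenerators A i = algebraMap Γ(X, U) A (c l) :=
    fun l => Ideal.mem_span_range_iff_exists_fun.mp (by rw [span_range_minGenerators]; exact hcm l)
  choose a ha using hexp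
  have ha' : ∀ l, algebraMap Γ(X, U) A (c l) = ∑ i, a l i * minGenerators A i := fun l => (ha l).symm
  have hd : directrixDim (tangentConeIdeal (minGenerators A) (span_range_minGenerators A)) = q + 1 := hdir
  -- (1) the charts at the generators, and the chart description of `S`
  have hcharts := fun j => exists_chart_of_ideal_eq_span₈ hπ U c hIc j
  choose g hgopen hgπ hgmem using hcharts
  have hkey : ∀ (j : Fin r) (w : Spec (.of (chartRing c j))),
      g j w ∈ S ↔
        ((U.2.primeIdealOf ⟨x, hxU⟩).asIdeal.map (CommRingCat.ofHom (chartBase c j)).hom ⊔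
          Ideal.span {d : chartRing c j | ∃ lam : Fin r → Γ(X, U),
            (linForm fun i => ∑ l, residue (X.presheaf.stalk x) ((X.presheaf.germ U x hxU).hom (lam l)) *
                residue (X.presheaf.stalk x) (a l i)) ∈
              directrixSpace (canonicalTangentConeIdeal (X.presheaf.stalk x)) ∧
            d = ∑ l, (CommRingCat.ofHom (chartBase c j)).hom (lam l) * chartGen c j l}) ≤ w.asIdeal := by
    intro j w
    haveI := hgopen j
    exact mem_projDirectrixFibre_chart_iff π U hxU (CommRingCat.ofHom (chartBase c j)) c j
      (fun l => chartGen c j l) a (g j) (hgπ j) (fun k => reesChartBase_apply_eq_mul_chartGen c j k)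
      (reesChartBase_mem_nonZeroDivisors (c j) (Ideal.mem_span_range_self (f := c) (x := j))) hx
      (h𝔭 ▸ hc) ha w
  -- (2) an adapted family of generators `c_{j_0}, …, c_{j_q}`
  obtain ⟨j, hjs, hji⟩ := exists_family_symbols_basis_mod_directrixSpace (span_range_minGenerators A) rfl hspanA a ha' hd
  -- (3) per-chart structure: `S ∩ chart = V(N)`, `Ξ : k(x)[T_1, …, T_q] ≅ D/N` with its values on `C`, `X`, and SURJ
  letI instF : Field (Γ(X, U) ⧸ 𝔭.asIdeal) := Ideal.Quotient.field 𝔭.asIdeal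
  have hchart : ∀ i₀ : Fin (q + 1),
      ∃ (N : Ideal (chartRing c (j i₀)))
        (Ξ : MvPolynomial (Fin q) (Γ(X, U) ⧸ 𝔭.asIdeal) ≃+* chartRing c (j i₀) ⧸ N),
        (∀ w : Spec (.of (chartRing c (j i₀))), g (j i₀) w ∈ S ↔ N ≤ w.asIdeal) ∧ N.IsPrime ∧
        (∀ ρ : Γ(X, U), Ξ (MvPolynomial.C (Ideal.Quotient.mk 𝔭.asIdeal ρ)) =
          Ideal.Quotient.mk N (chartBase c (j i₀) ρ)) ∧
        (∀ m : Fin q, Ξ (MvPolynomial.X m) = Ideal.Quotient.mk N (chartGen c (j i₀) (j (i₀.succAbove m)))) ∧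
        (∀ d : chartRing c (j i₀), ∃ p : MvPolynomial (Fin q) Γ(X, U),
          d - MvPolynomial.eval₂ (chartBase c (j i₀)) (fun m => chartGen c (j i₀) (j (i₀.succAbove m))) p ∈ N) := by
    intro i₀
    obtain ⟨hsp, hind⟩ := basis_mod_directrixSpace_succAbove (span_range_minGenerators A) a hjs hji i₀
    obtain ⟨Ξ, hΞC, hΞX⟩ := exists_ringEquiv_mvPolynomial_quotient_chartIdeal 𝔭.asIdeal A
      (span_range_minGenerators A) a ha (chartBase c (j i₀)) (fun l => chartGen c (j i₀) l) (j i₀)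
      (fun m => j (i₀.succAbove m)) (chartGen_self c (j i₀))
      (fun d => exists_isHomogeneous_eval₂_eq c (j i₀) d)
      (fun m F hF => reesChartBase_eval_eq_pow_mul_eval₂ c (j i₀) hF)
      (fun z hz => exists_pow_mul_eq_zero_of_reesChartBase_eq_zero c (j i₀) hz) hsp hind
    refine ⟨_, Ξ, fun w => ?_, isPrime_of_ringEquiv_mvPolynomial₈ _ Ξ, hΞC, hΞX, fun d => ?_⟩
    · rw [hkey (j i₀) w, h𝔭]
      exact Iff.rfl
    · exact exists_mvPolynomial_sub_eval₂_mem_chartIdeal 𝔭.asIdeal A (span_range_minGenerators A) a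
        (chartBase c (j i₀)) (fun l => chartGen c (j i₀) l) (j i₀) (fun m => j (i₀.succAbove m))
        (chartGen_self c (j i₀)) (fun d => exists_isHomogeneous_eval₂_eq c (j i₀) d) hsp d
  choose N Ξ hkeyN hprimeN hΞC hΞX hsurjN using hchart
  -- (4) every point of `S` lies on one of the `q + 1` charts
  have hcover : ∀ ξ ∈ S, ∃ i, ξ ∈ Set.range (g (j i)) := by
    intro ξ hξ
    obtain ⟨hξx, hP⟩ := (mem_projDirectrixFibre π x ξ).mp hξ
    have hξU : π.base ξ ∈ (U : X.Opens) := hξx ▸ hxU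
    let ι : A ≅ X.presheaf.stalk (π.base ξ) := X.presheaf.stalkCongr (.of_eq hξx.symm)
    haveI : IsLocalHom (π.stalkMap ξ).hom := π.toLRSHom.prop ξ
    let φ : A →+* X'.presheaf.stalk ξ := (π.stalkMap ξ).hom.comp ι.hom.hom
    have hφgerm : ∀ s : Γ(X, U), φ (algebraMap Γ(X, U) A s) =
        (π.stalkMap ξ).hom ((X.presheaf.germ U (π.base ξ) hξU).hom s) := by
      intro s
      rw [halg, RingHom.comp_apply]
      change (π.stalkMap ξ).hom ((X.presheaf.germ U x hxU ≫ ι.hom).hom s) = _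
      rw [TopCat.Presheaf.stalkCongr_hom, TopCat.Presheaf.germ_stalkSpecializes]
    have hφm : (maximalIdeal A).map φ ≤ maximalIdeal (X'.presheaf.stalk ξ) := by
      rw [Ideal.map_le_iff_le_comap]
      intro m hm
      rw [Ideal.mem_comap, RingHom.comp_apply]
      refine map_nonunit (π.stalkMap ξ).hom _ ?_
      rw [mem_maximalIdeal, mem_nonunits_iff] at hm ⊢
      have h2 : ι.inv.hom (ι.hom.hom m) = m := by
        change (ι.hom ≫ ι.inv).hom m = m
        rw [Iso.hom_inv_id]
        rfl
      exact fun hu => hm (h2 ▸ hu.map ι.inv.hom)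
    have hPφ : ProjDirLiftsInto φ (minGenerators A) (span_range_minGenerators A) :=
      (isOnProjDirectrix_iff_projDirLiftsInto π hξx).mp hP
    have hfam := map_maximalIdeal_eq_span_family_of_projDirLiftsInto (span_range_minGenerators A) a ha' hjs φ hφm hPφ
    obtain ⟨t, ht, hKt⟩ := hπ.isEffectiveCartier.exists_stalkIdeal_eq_span ξ
    have hK : stalkIdeal ((Scheme.IdealSheafData.vanishingIdeal (⟨{x}, hx⟩ : Closeds X)).comap π) ξ =
        Ideal.span (Set.range fun i => (π.stalkMap ξ).hom ((X.presheaf.germ U (π.base ξ) hξU).hom (c (j i)))) := by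
      rw [stalkIdeal_comap_eq_map, stalkIdeal_eq_map_germ _ U hξU, hIc, Ideal.map_map, Ideal.map_span,
        ← Set.range_comp]
      have h1 : Ideal.span (Set.range (((π.stalkMap ξ).hom.comp (X.presheaf.germ U (π.base ξ) hξU).hom) ∘ c)) =
          (maximalIdeal A).map φ := by
        rw [← hspanA, Ideal.map_span, ← Set.range_comp]
        exact congrArg Ideal.span (congrArg Set.range (funext fun l => (hφgerm (c l)).symm))
      rw [h1, hfam]
      exact congrArg Ideal.span (congrArg Set.range (funext fun i => hφgerm (c (j i))))
    obtain ⟨i, hi⟩ := exists_span_singleton_eq_of_span_range_eq₈ _ ht (hK.symm.trans hKt)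
    exact ⟨i, hgmem (j i) ξ hξU (hKt.trans hi.symm)⟩
  -- (5) specialisation from the chart points `ηpt i`; they all specialise to one another, so each is generic in `S`
  set ηpt : ∀ i : Fin (q + 1), Spec (.of (chartRing c (j i))) := fun i => ⟨N i, hprimeN i⟩ with hηpt
  have hηS : ∀ i, g (j i) (ηpt i) ∈ S := fun i => (hkeyN i (ηpt i)).mpr le_rfl
  have hspec : ∀ (i : Fin (q + 1)) (w : Spec (.of (chartRing c (j i)))), g (j i) w ∈ S →
      g (j i) (ηpt i) ⤳ g (j i) w := by
    intro i w hw
    have hsp : ηpt i ⤳ w :=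
      (PrimeSpectrum.le_iff_specializes (ηpt i) w).mp
        ((PrimeSpectrum.asIdeal_le_asIdeal (ηpt i) w).mp ((hkeyN i w).mp hw))
    exact hsp.map (g (j i)).continuous
  have hgenN : ∀ (i : Fin (q + 1)) (m : Fin q), chartGen c (j i) (j (i.succAbove m)) ∉ N i := by
    intro i m hmem
    have h1 : (Ξ i) (MvPolynomial.X m) = 0 := by
      rw [hΞX i m, Ideal.Quotient.eq_zero_iff_mem.mpr hmem]
    exact MvPolynomial.X_ne_zero m ((Ξ i).injective (h1.trans (map_zero (Ξ i)).symm))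
  have hηrange : ∀ i i', g (j i') (ηpt i') ∈ Set.range (g (j i)) := by
    intro i i'
    have hwU : π (g (j i') (ηpt i')) ∈ (U : X.Opens) := ((mem_projDirectrixFibre π x _).mp (hηS i')).1 ▸ hxU
    haveI := hgopen (j i')
    by_cases hii' : i = i'
    · subst hii'
      exact ⟨_, rfl⟩
    · obtain ⟨m, hm⟩ := Fin.exists_succAbove_eq hii'
      subst hm
      exact hgmem (j (i'.succAbove m)) _ hwU (stalkIdeal_exceptional_eq_span_of_notMem π U
        (CommRingCat.ofHom (chartBase c (j i'))) c (j i') (fun l => chartGen c (j i') l) (g (j i')) (hgπ (j i'))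
        (fun k' => reesChartBase_apply_eq_mul_chartGen c (j i') k') hx hIc (ηpt i') hwU (j (i'.succAbove m))
        (hgenN i' m))
  have hηη : ∀ i i', g (j i) (ηpt i) ⤳ g (j i') (ηpt i') := by
    intro i i'
    obtain ⟨w, hw⟩ := hηrange i i'
    rw [← hw]
    exact hspec i w (hw ▸ hηS i')
  have hgen : ∀ i, ∀ ξ ∈ S, g (j i) (ηpt i) ⤳ ξ := by
    intro i ξ hξ
    obtain ⟨i', w, rfl⟩ := hcover ξ hξ
    exact (hηη i i').trans (hspec i' w hξ)
  have hSclosed : IsClosed S := isClosed_projDirectrixFibre π x hx hπ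
  have hGP : ∀ i, IsGenericPoint (g (j i) (ηpt i)) S := by
    intro i
    refine isGenericPoint_iff_specializes.mpr fun ξ => ⟨fun h => ?_, fun h => hgen i ξ h⟩
    exact hSclosed.closure_subset_iff.mpr (Set.singleton_subset_iff.mpr (hηS i)) (specializes_iff_mem_closure.mp h)
  -- (6) `y` on a chart, and the chart computation
  obtain ⟨i, w, hw⟩ := hcover y hy
  haveI := hgopen (j i)
  subst hw
  have hNw : N i ≤ w.asIdeal := (hkeyN i w).mp hy
  have hwx : π.base (g (j i) w) = x := ((mem_projDirectrixFibre π x _).mp hy).1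
  have hwU : π.base (g (j i) w) ∈ (U : X.Opens) := hwx ▸ hxU
  have h𝔭eq : 𝔭.asIdeal = (U.2.primeIdealOf ⟨π (g (j i) w), hwU⟩).asIdeal := by
    rw [h𝔭]
    congr 2
    exact (Subtype.ext hwx).symm
  exact ringKrullDim_quotient_stalkIdeal_add_trdeg_of_chart π U (CommRingCat.ofHom (chartBase c (j i))) (g (j i))
    (hgπ (j i)) w hwU 𝔭.asIdeal h𝔭eq (fun m => chartGen c (j i) (j (i.succAbove m))) (N i) (hprimeN i) hNw (Ξ i)
    (hΞC i) (hΞX i) (hsurjN i) S hC (hGP i)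

end Literature.AlgebraicGeometry.CossartJannsenSaito2020

end
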